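import Mathlib
import HarnessLib
import HarnessLib.Audit
import Summits.AtomisticToContinuum.Statement
import Literature.MathematicalPhysics.KineticTheory.InfiniteChainDynamics
import Literature.MathematicalPhysics.KineticTheory.InfiniteChainInvariantStates
import Literature.MathematicalPhysics.KineticTheory.LangevinChainNESSHolds
import Summits.AtomisticToContinuum.FouriersLaw.Theorems.EmbeddedDrudeMourreNessUnique
import Summits.AtomisticToContinuum.FouriersLaw.Theorems.FourierGreenKuboFourierFiniteResponseOfUnique
import HarnessLib.Audit.Status.Attr

/-!
Route: CurrentTiltQuench

DORMANT since 2026-08-23T21:03:26Z (reconciler: no traction for 6.2 d (last activity item-evidence-added at 2026-08-17T14:38:07Z); parked, not closed — `ledger route dormant route-AtomisticToContinuum-CurrentTiltQuench --off` to reactiv) — unstaffed, not closed; items shared with open routes are served there. `ledger route dormant <id> --off` reactivates.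

# Route CurrentTiltQuench — bias the Gibbs state by the clipped current, quench and Cesàro-average —
odd-sector rigidity then forbids a Drude weight, and the bridge is one uniform-in-time second-order
response bound

X_CT (CURRENT-TILT RIGIDITY LINE; realises idea card doob-tilt-macroergodicity-bridge, REPAIRED
after its novelty audit; this is the
D-0027 §2.1-conforming re-open of route CurrentTiltRigidity — same items stmt-6019…6029 + shared
0717/0741/0742, retired 2026-08-15T13:41Z
only because its assembly had not been materialised with a deciding theorem — now with `theorem
closes … : _root_.FouriersLaw`, proved). Fix
pinnedChain ω₂ lam β γ (ω₂, lam, β > 0; γ is inert for the infinite chain), T > 0, a shift- and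
momentum-reversal-invariant Gibbs state
μ_T of the INFINITE chain and a μ_T-preserving, shift-covariant infinite-volume dynamics φ
(InfiniteChainDynamics; existence = support
SymmetricSetup). Clip the bond current at level M, F_M(u) = max(−M, min(M, u)); bias μ_T by the
bounded local weight
exp(ε Σ_{|x|≤L} F_M(j_x)) (a current-carrying perturbed Gibbs state ν_{ε,L}), let φ act,
Cesàro-average over [0, τ]. It suffices to show
X_CT = X1 ∧ X2 ∧ X3 ∧ X4 (plus the shared finite-N items):
 X1 (UniformQuadraticResponse, crux 2): the Cesàro-averaged clipped current after the quench equals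
its Kubo first-order term ε·A_M(L,τ),
    A_M(L,τ) = τ⁻¹∫₀^τ Cov_{μ_T}(Σ_{|x|≤L} F_M(j_x), F_M(j_0)∘φ_t) dt, up to K·ε², UNIFORMLY in τ ≥
1 and in L;
 X2 (QuenchCurrentDies, crux 4): if every shift-invariant, time-invariant, regular state gives zero
mean to F_M(j_0), the Cesàro-averaged
    quench current tends to 0 (τ → ∞, then L → ∞) — compactness: limit points of the averaged quench
states are exactly such states;
 X3 (BoundedOddRigidity, crux 3): the ODD SECTOR of macro-ergodicity — every shift-invariant,
time-invariant (∫𝒜f dν = 0), regular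
    probability measure of the infinite pinned chain has ∫ F_M(j_0) dν = 0 for every M (implies
ZeroCurrentRigidity = stmt-2739 of route
    LocalOhmRigidity: support OddRigidityTransfer, proved in the planner sketch);
 X4 (GreenKuboOfNoDrude, crux 5, import slot): Green–Kubo for the infinite chain (body of stmt-0703
at T) GIVEN that all truncated
    Drude weights vanish.
X1 ∧ X2 ∧ X3 give NoTruncatedDrude (the deliverable: no ballistic channel; = zero Drude weight
σ_T({0}) = 0 by support
DrudeFromTruncation; glue BridgeGlue proved in the sketch), X4 converts it into stmt-0703, and
NessUnique (stmt-0741),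
FiniteResponseOfUnique (stmt-0717), ThermodynamicLimit (stmt-0742) finish exactly as in route
FourierGreenKubo. Contrapositively and
WITHOUT X3, X1 ∧ X2 prove the card's structure theorem FluctuationStateDichotomy: a positive
truncated Drude weight manufactures a regular,
space-time-invariant, current-carrying (hence non-Gibbsian) state out of equilibrium current
fluctuations.
Lean: `UniformQuadraticResponse ∧ QuenchCurrentDies ∧ BoundedOddRigidity ∧ GreenKuboOfNoDrude ∧
NessUnique ∧ FiniteResponseOfUnique ∧ ThermodynamicLimit`

## Assembly
DECIDING THEOREM (D-0027 §2.1), supplied with `--closes-file glue.lean` and PROVED sorry-free in the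
planner's Sketch.lean (rc 0, ~80 lines,
std axioms): `theorem closes (hU : UniformQuadraticResponse) (hQ : QuenchCurrentDies) (hB :
BoundedOddRigidity) (hGK : GreenKuboOfNoDrude)
(hNU : NessUnique) (hFR : FiniteResponseOfUnique) (hTL : ThermodynamicLimit) : _root_.FouriersLaw` —
hypotheses are seven of this route's own
items, conclusion the sub-problem Statement decl itself. Proof: (1) the bridge
UniformQuadraticResponse + QuenchCurrentDies +
BoundedOddRigidity ⇒ NoTruncatedDrude (pure logic plus |εX| ≤ |Y − εX| + |Y| with ε = min(ε₀,
η/(2(|K|+1))), δ = εη/2; also filed as the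
support item BridgeGlue, already proved by refuter g40-52 on the retired twin), whose body after T
is literally the antecedent of
GreenKuboOfNoDrude, giving the stmt-0703 body at every T > 0; (2) clause (i) of FouriersLawFor from
the landed fact
Literature.MathematicalPhysics.KineticTheory.HeatConduction.pinnedChain_exists_isSteadyState +
NessUnique; κ T := greenKuboConductivity of
the Classical.choose witnesses of ThermodynamicLimit (T > 0, else 1), positive by HasGreenKubo.pos;
for a steady-state family the D_N come
from FiniteResponseOfUnique and the ThermodynamicLimit spec gives D_N → κ T. The optional Assembly
ITEM records the same implication as a Prop.

Rationale: WHY THIS LINE. The card tilted μ_T by time-AVERAGED currents and let τ → ∞ at fixed box; its audit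
(refuter-novelty-audit-…-4-g2-0) showed that von
Neumann's theorem then kills the tilt even for the ballistic harmonic chain (single-site time
averages → 0 in L², the Drude weight lives in
the light-cone sum), and that un-truncating inside the light cone is a cluster-expansion problem,
"not soft". The repair moves the tilt
to time ZERO — bias by the instantaneous CLIPPED current, a bounded finite-range Gibbs perturbation
(explicit, regular, no exponential
moments of the cubic current needed) — and reads the Drude weight off the FIRST-ORDER (Kubo)
response of the Cesàro-averaged quench
current (Mazur1969, Suzuki1971, Doyon2022; the von Neumann/Mazur Hilbert-space machinery is PROVED
in tree,
Literature.Barriers.AtomisticToContinuum.MazurBoundBallistic: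
`Mazur.tendsto_inv_mul_integral_inner`), removing the truncation STATICALLY
in ℋ₀ by unitarity; what remains is isolated honestly as ONE uniform-in-time second-order response
bound (X1: boundedness, not decay, of a
Cesàro-averaged dynamical three-point cumulant — true for the harmonic chain by trace-norm
conservation under the Σ-orthogonalised flow)
and ONE Krylov–Bogoliubov/entropy compactness step (X2). Imported, with dictionary: the
driven/tilted-process construction of stochastic
transport theory run BACKWARDS as an impossibility argument (Chetrite–Touchette
doi:10.1007/s00023-014-0375-8, BertiniEtAl2015;
deterministic tilts Kifer1990, Jakšić–Pillet–Rey-Bellet doi:10.1088/0951-7715/24/3/003): 'tilt by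
the current' ↦ e^{εΣF_M(j_x)}μ_T,
'driven process' ↦ Cesàro limit of the quench, 'rate-function curvature' ↦ truncated Drude weight;
hydrodynamic projections (Doyon2022)
give the first-order identity; response theory of chaotic dynamics (Ruelle2009, van Kampen's
objection) names the risk in X1; convergence
of harmonic quenches to the current-carrying states of SpohnLebowitz1977 (doi:10.1007/bf01010871) is
the calibration. Versus the tree:
FourierGreenKubo attacks C_T ∈ L¹ by decay; LocalOhmRigidity uses the odd sector for OPEN-chain NESS
windows → bounded response; this line
makes the same rigidity statement pay on the CLOSED chain's Green–Kubo side (anti-ballistic half of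
stmt-0703), so the shared rigidity
statement is now wanted by two mechanisms, and it yields the unconditional dichotomy theorem; route
NoHiddenCharges (opened concurrently)
reaches the same target ZeroDrudeWeight (stmt-3657) by CHARGE CLASSIFICATION + completeness + Doyon
projection — this line needs no
classification and no completeness (it trades them for rigidity), and its NoTruncatedDrude +
DrudeFromTruncation close the Cesàro clause of
stmt-3657 on any GibbsHydroStructure witness (stmt-3658 satisfies this line's symmetric set-up), a
second, logically independent proof path.
Negatives index empty; nothing refuted is approached.

RANKED CRUXES. #2 UniformQuadraticResponse (crux) — (card item CurrentSurvives, repaired) for the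
symmetric set-up (μ_T, φ), every M > 0 and F = F_M: there are ε₀ > 0 and K such that for 0 < ε ≤ ε₀,
every τ ≥ 1 and all L ≥ L₀(ε,τ): |τ⁻¹∫₀^τ [⟨F(j_0)∘φ_t⟩_{ν_{ε,L}} − ⟨F(j_0)⟩_{μ_T}] dt − ε·A_M(L,τ)|
≤ K ε², where ν_{ε,L} = e^{εG_L}μ_T/Z, G_L = Σ_{|x|≤L} F(j_x) and A_M(L,τ) = τ⁻¹∫₀^τ Cov_{μ_T}(G_L,
F(j_0)∘φ_t)dt. The uniform-in-time second-order Taylor remainder of the quench response = ½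
sup_{ε'≤ε} of the Cesàro-averaged third cumulant κ₃^{ν_ε'}(G_L, G_L, F(j_0)∘φ_t). Harmonic
calibration (F = id, Gaussian quench, by hand): remainder = ½ε² tr(B̃_t Ã² (1−εÃ)⁻¹), |·| ≤
½ε²‖B̃‖₁‖Ã‖²/(1−ε‖Ã‖) uniformly in t, L. [difficulty: XL] (why it might fail: Chaos may make
F(j_0)∘φ_t respond at second order like a generic range-vt observable, |∂²_ε⟨F(j_0)∘φ_t⟩_ν_ε| ~
(vt)^a, not Cesàro-bounded (van Kampen objection, Ruelle2009); no response bound uniform in t beyond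
first order is known for any anharmonic chain.) [Ruelle2009, Doyon2022, Mazur1969, Suzuki1971,
SpohnLebowitz1977, doi:10.1007/bf01010871, Kifer1990, doi:10.1088/0951-7715/24/3/003]
#3 BoundedOddRigidity (crux) — (the card's named hypothesis OddMacroErgodicity, typed for bounded
observables) for ω₂, lam, β > 0: every probability measure on (ℝ×ℝ)^ℤ that is shift-invariant,
time-invariant for the infinite deterministic pinned chain in the generator sense (∫𝒜f dν = 0, f ∈
C₀¹) and regular (decls IsShiftInvariant / IsTimeInvariant / IsRegular of
Literature.MathematicalPhysics.KineticTheory.InfiniteChainInvariantStates — the fact-free home of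
the infinite-chain vocabulary; route-repair 2026-08-15 re-homed the route there from the aliases of
the barrier file MacroErgodicityHypothesis.lean, definitionally equal) gives zero mean to every
clipped bond current, ∫ max(−M, min(M, j_0)) dν = 0 (M > 0). Implied by MacroErgodicityHypothesis +
reversal symmetry of the Gibbs states (support OddRigidityOfMacroErgodicity); implies
ZeroCurrentRigidity = stmt-AtomisticToContinuum-2739 by dominated convergence (support
OddRigidityTransfer, PROVED in the sketch); false at lam = β = 0 (current-carrying Gaussian
stationary states, SpohnLebowitz1977). Needed only at ONE large M per temperature. [difficulty:
open-problem] (why it might fail: Regular current-carrying invariant states may exist without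
integrability: KAM/breather tori of the infinite lattice (FFL1994 p.215) or a hidden quasi-local odd
charge Q (state e^(λQ)μ_T, Mazur1969); open for every deterministic anharmonic chain.)
[FritzFunakiLebowitz1994, Bernardin2014, SpohnLebowitz1977, Mazur1969, GurevichSuhov1976]
#4 QuenchCurrentDies (crux) — (card item TiltedStateLimit, repaired order of limits) for the
symmetric set-up, M, ε > 0: IF every shift-invariant, time-invariant, regular probability ν has
∫F_M(j_0)dν = 0, THEN ∀δ>0 ∃τ₀ ∀τ≥τ₀ ∃L₀ ∀L≥L₀: |τ⁻¹∫₀^τ[⟨F_M(j_0)∘φ_t⟩_{ν_{ε,L}} −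
⟨F_M(j_0)⟩_{μ_T}]dt| ≤ δ. Proof plan (compactness): the Cesàro-averaged quench states ν̄_{τ,L} =
τ⁻¹∫₀^τ(φ_t)_*ν_{ε,L}dt are tight (superstability); L → ∞ limit points are shift-invariant
(shift-covariance + quasi-locality of φ_t + Gibbs mixing) with box entropies ≤ CεM(|Λ| + vτ); τ → ∞
limit points have specific entropy ≤ CεM, hence (shift-invariance, Markov reference) are regular;
they are time-invariant because ∫𝒜f dν̄_τ = τ⁻¹⟨f∘φ_τ − f⟩ = O(‖f‖_∞/τ) with 𝒜f uniformly integrable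
(|𝒜f| ≲ Σ|p| + |q|³ against quartic pinning), and carry the limiting clipped current (bounded
continuous); rigidity forces 0, while ⟨F_M(j_0)⟩_{μ_T} = 0 by reversal symmetry. [difficulty: L]
(why it might fail: Needs light-cone quasi-locality of the infinite QUARTIC-chain flow (L-uniform
box entropies; shift-invariance of limits) and box-regularity from specific entropy w.r.t. a
non-product Gibbs reference — printed only in parts (LLL1977 a.e. flow, ButtaEtAl2007 bounds).)
[LanfordLebowitzLieb1977, ButtaEtAl2007, Bernardin2014, FritzFunakiLebowitz1994, Georgii2011,
KipnisLandim1999]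
#5 GreenKuboOfNoDrude (crux) — IMPORT SLOT ('Green–Kubo minus the ballistic atom'): for all
parameters > 0 and T > 0, IF for every symmetric set-up (μ_T, φ) and every M the truncated Drude
weight vanishes in the NoTruncatedDrude form (∀η ∃τ₀ ∀τ≥τ₀ ∃L₀ ∀L≥L₀ |A_M(L,τ)| ≤ η), THEN there are
a Gibbs state and a μ_T-preserving dynamics with HasGreenKubo (C_T absolutely convergent, in
L¹(0,∞), κ_GK > 0) — literally the body of crux FourierGreenKubo (stmt-AtomisticToContinuum-0703) at
T. NOT this route's mechanism: the residual is the REGULAR part of the current spectral measure σ_T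
near 0 (integrable Fourier transform, positive density), the object of cards
herglotz-current-spectral-measure / embedded-drude-eigenvalue-mourre-fgr and of route
FourierGreenKubo; any decay proof of 0703 closes it a fortiori. [deps: NoTruncatedDrude,
SymmetricSetup] [difficulty: open-problem] (why it might fail: It is stmt-0703 minus σ_T(0) = 0: C_T
may fail to be L¹ with no atom at 0 (singular-continuous σ_T near 0, breather tails) or κ_GK may
vanish; and the antecedent is vacuous unless the symmetric set-up exists (support SymmetricSetup).)
[BonettoLebowitzReyBellet2000, Bernardin2014, Mazur1969, Suzuki1971, CanestrariLiveraniOlla2026]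
#9 NoTruncatedDrude (support) — THE DELIVERABLE (no ballistic channel, truncated form): for every
symmetric set-up (μ_T, φ) of pinnedChain (ω₂, lam, β > 0), T > 0, every M, η > 0: ∃τ₀ ∀τ≥τ₀ ∃L₀
∀L≥L₀ |τ⁻¹∫₀^τ Cov_{μ_T}(G_L, F_M(j_0)∘φ_t)dt| ≤ η. Closed by BridgeGlue from ranks 2–4; stated
alone so that FourierGreenKubo (Cesàro half of stmt-0703), the Herglotz card and the junction/Fekete
lines can want it. [difficulty: L] [Mazur1969, Suzuki1971, Doyon2022]
#9 BridgeGlue (support) — UniformQuadraticResponse → QuenchCurrentDies → BoundedOddRigidity →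
NoTruncatedDrude: pure logic plus |εX| ≤ |Y − εX| + |Y| with ε = min(ε₀, η/(2(|K|+1))), δ = εη/2
(PROVED in the planner's Sketch.lean, theorem bridgeGlue, rc 0 — a prover may copy it). [difficulty:
provable-now] [Mazur1969, folklore (planner Sketch.lean theorem bridgeGlue)]
#9 FluctuationStateDichotomy (support) — THE CARD'S BY-PRODUCT THEOREM as a provable-now schema
(refuter g40-52's advice on the retired twin: typed WITH its two antecedents):
UniformQuadraticResponse → QuenchCurrentDies → for a symmetric set-up and M > 0, if the truncated
Drude weight does NOT vanish (∃η>0 such that for unboundedly many τ and, given τ, unboundedly many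
L, |A_M(L,τ)| > η), then there is a shift-invariant, time-invariant, REGULAR probability measure of
the infinite pinned chain with non-zero mean clipped current — a non-Gibbsian space-time-invariant
state manufactured from equilibrium current fluctuations (harmonic picture: the current-carrying
Gaussian states of SpohnLebowitz1977). Pure logic (PROVED in the sketch, theorem dichotomy, rc 0).
[difficulty: provable-now] [SpohnLebowitz1977, doi:10.1007/bf01010871, FritzFunakiLebowitz1994]
#9 DrudeFromTruncation (support) — TRANSLATION TO THE CLASSICAL DRUDE WEIGHT: for a symmetric set-up
whose current correlations converge absolutely at all times (HasAbsConvergentCorrelation, as inside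
HasGreenKubo), NoTruncatedDrude at (μ_T, φ) for all M implies τ⁻¹∫₀^τ currentCorrelation dt → 0
(σ_T({0}) = 0). Content: von Neumann in ℋ₀ (PROVED abstractly in tree:
Mazur.tendsto_inv_mul_integral_inner) — Cesàro limits exist and equal ‖P₀·‖²; P₀ is a contraction
and ‖j_0 − F_M(j_0)‖_ℋ₀ → 0 is a STATIC Gibbs estimate (summable covariances of local functions), so
√D ≤ √D_M + o_M(1); plus the L → ∞ swap at fixed τ (dominated convergence from quasi-locality).
[difficulty: M] [Mazur1969, Suzuki1971, Doyon2022, decl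
Literature.Barriers.AtomisticToContinuum.Mazur.tendsto_inv_mul_integral_inner]
#9 OddRigidityOfMacroErgodicity (support) — the catalogue hypothesis implies the crux:
MacroErgodicityHypothesis (its body written out verbatim, ∀ parameters > 0, IsMacroErgodic
(pinnedChain …), as the antecedent) → (every DLR Gibbs state of pinnedChain at every T' > 0 is
momentum-reversal invariant — the 1-D uniqueness/symmetry input made an explicit hypothesis) →
BoundedOddRigidity (ν = ∫μ_T' π(dT'); F_M(j_0) is bounded and odd under p ↦ −p; Measure.bind
integral). [difficulty: provable-now] [Bernardin2014, FritzFunakiLebowitz1994, Georgii2011]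
#9 OddRigidityTransfer (support) — BoundedOddRigidity → ZeroCurrentRigidity of route
LocalOhmRigidity (consequent = stmt-AtomisticToContinuum-2739 copied verbatim): clip at level n+1
and let n → ∞ by dominated convergence (|F_(n+1)(j_0)| ≤ |j_0| ∈ L¹(ν)). PROVED in the planner's
Sketch.lean (theorem oddRigidityTransfer, rc 0): provers of rank 3 close stmt-2739 as well.
[difficulty: provable-now] [FritzFunakiLebowitz1994, folklore (planner Sketch.lean theorem
oddRigidityTransfer)]
#9 SymmetricSetup (support) — DE-VACUIFIER / infrastructure (InfiniteVolumeSetup = stmt-0743 of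
FourierGreenKubo strengthened by the symmetries this line uses): for ω₂, lam, β > 0 (any γ) and T >
0 there are a DLR Gibbs state μ_T that is shift-invariant and momentum-reversal invariant (1-D
transfer operator e^(−U/2T)e^(−V(q′−q)/T)e^(−U/2T), Hilbert–Schmidt since U ≥ ω₂q²/2: unique, hence
symmetric) and an InfiniteChainDynamics preserving μ_T whose flow commutes with the shift μ_T-a.e.
(LLL1977 Thm 3 a.e. existence on a shift-invariant tempered carrier + a uniqueness class;
ButtaEtAl2007 for quartic forces). [difficulty: L] [LanfordLebowitzLieb1977, ButtaEtAl2007,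
Georgii2011]
#9 NessUnique (support) — shared verbatim with routes FourierGreenKubo / LocalOhmRigidity /
FeketeResistance (stmt-AtomisticToContinuum-0741): uniqueness of the weak steady state of the finite
Langevin chain for all N, T_L, T_R > 0 (with the landed existence fact it is clause (i) of
FouriersLawFor). [difficulty: M] [CuneoEckmannHairerReyBellet2018, Carmona2007]
#9 FiniteResponseOfUnique (support) — shared verbatim (stmt-AtomisticToContinuum-0717): under
weak-NESS uniqueness the finite-N linear-response limits D_N(T) exist (Hairer–Majda / Rey-Bellet
differentiability at equilibrium). [difficulty: M] [HairerMajda2009, ReyBellet2003]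
#9 ThermodynamicLimit (support) — shared verbatim, IMPORT (stmt-AtomisticToContinuum-0742, crux rank
3 of route FourierGreenKubo, witness form): given Green–Kubo at T, some (μ_T, D) has D_N → κ_GK(D,
μ_T, T) along every steady-state family; not this route's mechanism. [difficulty: open-problem]
[BonettoLebowitzReyBellet2000, ReyBellet2003, KunduDharNarayan2009]

TWO-LAYER PLAN. Foreseen glued splits (nothing filed now): QuenchCurrentDies ⇐ FlowQuasiLocality →
AveragedStateRegularity → QuenchCurrentDies (k = 2:
light-cone dependence estimates for the quartic-chain flow; then tightness + shift-invariance +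
box-regularity-from-specific-entropy +
generator-form invariance of Cesàro limits); UniformQuadraticResponse ⇐ StaticTiltAnalyticity →
CesaroThirdCumulantBound →
UniformQuadraticResponse (k = 2: analyticity in ε of the perturbed 1-D Gibbs state on quasi-local
observables with range-dependent bounds;
then the dynamical input — Cesàro-boundedness of Σ_(x,x') κ₃(F(j_x), F(j_x'), F(j_0)∘φ_t));
SymmetricSetup ⇐ SymmetricGibbs →
CovariantFlow (k = 2). GreenKuboOfNoDrude and ThermodynamicLimit split, if ever, inside route
FourierGreenKubo.

KILL CRITERIA. (a) A shift-invariant, regular, time-invariant state of the infinite chain with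
non-zero clipped current at some lam, β > 0 refutes
BoundedOddRigidity → close `refuted:BoundedOddRigidity` (it also breaks LocalOhmRigidity's stmt-2739
when j_0 is ν-integrable; if the
witness is a conserved odd charge, Mazur1969_inequality makes stmt-0703 false and the conjunct
suspect → hand the witness to card
open-chain-mazur-bridge). (b) UniformQuadraticResponse refuted (analytic counterexample, or
certified growth of the second-order remainder
with τ) kills THIS line's bridge only → pivot once to the convexity variant (free-energy lower bound
f_τ(λ) ≥ cλ²A_τ for the DYNAMIC tilt by
time-averaged clipped currents, L → ∞ first) or close `refuted:UniformQuadraticResponse`. (c)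
QuenchCurrentDies refuted because Cesàro quench
limits fail box-regularity → restate with specific-entropy regularity (new decl) or close. (d)
stmt-0703 proved by decay elsewhere moots
ranks 2, 4, 5 (NoTruncatedDrude follows); the route then survives only through rank 3's cross-route
role → close `superseded`.
(e) MacroErgodicityHypothesis proved ⇒ rank 3 closes via OddRigidityOfMacroErgodicity.

NOT DECOMPOSED YET. The light-cone quasi-locality lemma for the quartic-chain flow, superstability
tightness of bounded finite-range perturbations, and
box-regularity from specific entropy against a Markov (non-product) Gibbs reference (layer-2
children of QuenchCurrentDies); the static
analyticity and the dynamical three-point bound behind UniformQuadraticResponse; 1-D DLR uniqueness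
/ reversal symmetry (inside
SymmetricSetup and OddRigidityOfMacroErgodicity); the harmonic calibration as a TYPED item (needs a
harmonic InfiniteChainDynamics object,
not in tree — recorded as the cheapest falsifier instead); the card's one-bond twin (zero-frequency
bond noise S_∞(0) = 0, a temperature-step
quench) — left to cards macro-ergodicity-parity-antiballistic (its P2) and
escape-deficit-boundary-tail; the passage closed chain → open
chain beyond GreenKuboOfNoDrude + ThermodynamicLimit; the ~40-line wiring item NoTruncatedDrude →
DrudeFromTruncation → (GibbsHydroStructure
witness of route NoHiddenCharges, stmt-3658) → ZeroDrudeWeight (stmt-3657), to be filed by tenure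
once either side moves (item cap at open).

CHEAPEST FALSIFIER. (1) By hand, the harmonic calibration with F = id (allowed there: j is a
quadratic form with small exponential moments): Gaussian quench
e^(εJ_L)μ_T of pinnedChain ω₂ 0 0; the planner's computation gives remainder ½ε² tr(B̃_t Ã²(1−εÃ)⁻¹)
with B̃_t = Σ^½B_tΣ^½ of constant trace
norm under the Σ-orthogonal flow, so UniformQuadraticResponse HOLDS uniformly in t, L and the quench
converges to SpohnLebowitz1977's
current-carrying states (rank 3 false, dichotomy sharp) — a refuter should re-derive it; a failure
there kills rank 2's mechanism.
(2) kit MD (not in the plancard budget; for refuters): pinnedChain 1 1 1 1, T = 1, equilibrium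
Langevin samples reweighted by e^(εG_L)
(L = 64, M = 3, ε ∈ {0.05, 0.1, 0.2}), Hamiltonian evolution, measure [m(ε,L,τ) − εA(L,τ)]/ε² for τ
≤ 500: bounded in τ supports rank 2,
growth ∝ τ refutes it. (3) Lookup (done, negative): no printed 'D > 0 ⇒ regular non-Gibbs invariant
state' or uniform-in-time second-order
response bound for an anharmonic lattice (crossref ×7, frontier, bridges; galaxy saturated this
hour).

NUMBERS. Harmonic corner: D(T) > 0, J = fluxCoeff·δT independent of N (HarmonicChainBallisticFlux,
in tree); pinned anharmonic numerics: κ(T) finite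
with κ ~ T^(−1.35) for the φ⁴ chain (AokiLukkarinenSpohn2006), i.e. D = 0 expected at every T > 0.
Entropy budget of the tilt: specific
relative entropy ≤ 2εM per site (bounded perturbation), independent of τ, L. Items at open: 15 (4
cruxes, 10 support, 1 assembly) + the deciding theorem `closes`.

DEFINITION REQUESTS. None filed: the clipped current F_M(j_x), the tilt weight e^(εG_L), the quench
means and the Cesàro coefficients are written inline over
bondCurrentZ / InfiniteChainDynamics.flow / currentCorrelation and the InfiniteChainInvariantStates
predicates (IsShiftInvariant,
IsTimeInvariant P ν, IsRegular P ν; fact-free module — since route-repair 2026-08-15 the route no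
longer imports
Literature.Barriers.AtomisticToContinuum.MacroErgodicityHypothesis, whose open XL hypothesis and
LangevinChainSDE/Hörmander cone had
ridden into the route cone on the vocabulary aliases; OddRigidityOfMacroErgodicity spells the
hypothesis out verbatim); a readability definition file Theorems/CurrentTiltRigidityDefs.lean
(quenchMean, cesaroKubo) may be posited by
the first prover. No cite facts wanted: the Mazur/von Neumann machinery is proved in
MazurBoundBallistic.lean.

Novelty: Searches (2026-08-15): `lit search --source crossref` ×7 — "current carrying stationary states
infinite harmonic chain" (SpohnLebowitz1977
doi:10.1007/bf01614132; Boldrighini–Pellegrinotti–Triolo 1983 doi:10.1007/bf01010871; Dudnikova 2019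
doi:10.1134/s1061920819040034;
Carinci–Giardinà–Presutti 2019 doi:10.1007/s10955-019-02427-9, stochastic), "Drude weight
pseudolocal conserved charges GGE Doyon"
(Doyon–Spohn doi:10.21468/scipostphys.3.6.039), "entropic fluctuations classical dynamical systems"
(JPR doi:10.1088/0951-7715/24/3/003),
"linear response uniform in time nonlinear response chaotic" (Cessac–Sepulchre 2007, Abramov–Majda
2007: finite-dimensional chaos only),
"large deviations time integrated current Hamiltonian chain anharmonic" (0 relevant), "relaxation
from tilted Gibbs state quench persistent
current classical chain" (quantum GGE papers only), "specific entropy conserved Hamiltonian dynamics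
infinite lattice" (0 relevant);
`lit frontier AtomisticToContinuum --since 2020` (30 rows; only CanestrariLiveraniOlla2026 on
deterministic bulk, unrelated mechanism);
`lit bridges AtomisticToContinuum --cross any` (nothing on tilts/Drude); `lit galaxy search "…"
--star all` ×3 (service saturated, 0 rows);
the local searchd was down (connection reset); the card's own searches and its novelty audit
(Mazur/Suzuki, Gurevich–Suhov, SpohnLebowitz1977,
FFL94, Kifer1990, Chetrite–Touchette, Doyon2022) adopted; `ledger negatives` (0); all 103 cards of
the sub and the 4 open routes re  [refs: 10.1007/bf01614132, 10.1007/bf01010871, 10.1134/s1061920819040034, 10.1007/s10955-019-02427-9, 10.21468/scipostphys.3.6.039, 10.1088/0951-7715/24/3/003, 10.1007/s00220-017-2836-7, doi:10.1007/bf01614132, doi:10.1007/bf01010871, doi:10.1134/s1061920819040034, doi:10.1007/s10955-019-02427-9, doi:10.21468/scipostphys.3.6.039, doi:10.1088/0951-7715/24/3/003, doi:10.1007/s00220-017-2836-7, SpohnLebowit]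

Barriers (technique_class: current-tilt-quench, cesaro-averaging, odd-macroergodicity): - technique_class: current-tilt-quench, cesaro-averaging, odd-macroergodicity
- Literature.Barriers.AtomisticToContinuum.MacroErgodicityBarrier: EMBRACED, not evaded — rank 3 is
the odd sector of the barrier's open auxiliary MacroErgodicityHypothesis (strictly weaker: no
classification of invariant states; OddRigidityOfMacroErgodicity records the implication); the
barrier's formal kernel (sector-condition failure, SectorCondition.eq_zero_of_symm_zero) is
irrelevant because no hydrodynamic limit, one-block estimate or fluctuation–dissipation
decomposition is taken — the payoff is extracted by a quench + compactness; the bet is that the odd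
sector is provable where the full classification is not.
- Literature.Barriers.AtomisticToContinuum.Mazur1969_inequality (MazurBoundBallistic): consistent
and USED — a conserved odd charge Q overlapping J makes D > 0 (the entry) and simultaneously refutes
rank 3 (e^(λQ)μ_T is regular, invariant, current-carrying); ranks 2 + 4 turn ANY positive truncated
Drude weight, charge or not, into such a state (FluctuationStateDichotomy), the constructive link
between the two catalogue entries the card promised; the entry's proved von Neumann lemmas are this
line's tools (DrudeFromTruncation).
- Literature.Barriers.AtomisticToContinuum.HarmonicChainBallisticFlux: calibration, not obstruction
— at lam = β = 0 rank 3 is false (SpohnLebowitz1977), D > 0, rank 2 holds (Gaussian computation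
above) and rank 4's contrapositive produces the current-carrying Ga

History (route lifecycle, newest last):
- 2026-08-15T16:37:43Z · rev 5: restated UniformQuadraticResponse (stmt-AtomisticToContinuum-9185), BoundedOddRigidity (stmt-AtomisticToContinuum-9186), QuenchCurrentDies (stmt-AtomisticToContinuum-9187), GreenKuboOfNoDrude (stmt-AtomisticToContinuum-9188), NoTruncatedDrude (stmt-AtomisticToContinuum-9189), FluctuationStateDichotomy (stmt-Atom (planner-rrepair-AtomisticToContinuum-CurrentTi-4831b40c-g2-0)
- 2026-08-23T21:03:26Z · DORMANT — reconciler: no traction for 6.2 d (last activity item-evidence-added at 2026-08-17T14:38:07Z); parked, not closed — `ledger route dormant route-AtomisticToConti (operator:999:2468797)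

sub-problem: FouriersLaw · status: dormant · opened planner-plancard-AtomisticToContinuum-Fourier-f15ce483-0 2026-08-15T13:51:47Z · rev 5 · ledger route-AtomisticToContinuum-CurrentTiltQuench
GENERATED by the gate from the ledger (D-0016/17). Provers cite these decls: `theorem foo : Summit.AtomisticToContinuum.FouriersLaw.Theses.CurrentTiltQuench.<Decl> := …` in Summits/AtomisticToContinuum/FouriersLaw/Theorems/<Name>.lean.
-/

namespace Summit.AtomisticToContinuum.FouriersLaw.Theses.CurrentTiltQuench

open scoped BigOperators Topology Manifold Classical MeasureTheory ProbabilityTheory Matrix InnerProductSpace ComplexConjugate ContinuousMap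
open Filter Set Function TopologicalSpace MeasureTheory

attribute [summit_statement] _root_.FouriersLaw

-- earlier UniformQuadraticResponse (stmt-AtomisticToContinuum-9185, replaced 2026-08-15T16:37:43Z -> stmt-AtomisticToContinuum-11026): retired by None — ∀ ω₂ lam β γ : ℝ, 0 < ω₂ → 0 < lam → 0 < β → ∀ T : ℝ, 0 < T → ∀ μ : MeasureTheory.Measure Literature.MathematicalPhysics.KineticTheory.HeatConduction.ChainConfig, (Literature.MathematicalPhysics.KineticTheory.HeatConduction.pinnedChain ω₂ lam β γ).I
/-- item stmt-AtomisticToContinuum-11026 · crux · rank 2 · open · by planner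
why it might fail: False if D_M(T)>0 while quench currents relax (forces K ≳ D_M/ε): it carries the whole anti-ballistic content. Remainder = Cesàro mean of ½ΣΣκ₃(F(j_x),F(j_x'),F(j_0)∘φ_t); generic tilt-analyticity bounds grow like the light cone (vt)^a (van Kampen, Ruelle2009); no uniform-in-t 2nd-order bound known.
sources: Ruelle2009, Mazur1969, Suzuki1971, Doyon2022, SpohnLebowitz1977, doi:10.1007/bf01010871
[crux] (card item CurrentSurvives, repaired) for the symmetric set-up (μ_T, φ), every M > 0 and F =
F_M: there are ε₀ > 0 and K such that for 0 < ε ≤ ε₀, every τ ≥ 1 and all L ≥ L₀(ε,τ): |τ⁻¹∫₀^τ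
[⟨F(j_0)∘φ_t⟩_{ν_{ε,L}} − ⟨F(j_0)⟩_{μ_T}] dt − ε·A_M(L,τ)| ≤ K ε², where ν_{ε,L} = e^{εG_L}μ_T/Z,
G_L = Σ_{|x|≤L} F(j_x) and A_M(L,τ) = τ⁻¹∫₀^τ Cov_{μ_T}(G_L, F(j_0)∘φ_t)dt. The uniform-in-time
second-order Taylor remainder of the quench response = ½ sup_{ε'≤ε} of the Cesàro-averaged third
cumulant κ₃^{ν_ε'}(G_L, G_L, F(j_0)∘φ_t). Harmonic calibration (F = id, Gaussian quench, by hand):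
remainder = ½ε² tr(B̃_t Ã² (1−εÃ)⁻¹), |·| ≤ ½ε²‖B̃‖₁‖Ã‖²/(1−ε‖Ã‖) uniformly in t, L. [difficulty:
XL] -/
@[route_item "route-AtomisticToContinuum-CurrentTiltQuench", crux]
def UniformQuadraticResponse : Prop :=
  ∀ ω₂ lam β γ : ℝ, 0 < ω₂ → 0 < lam → 0 < β → ∀ T : ℝ, 0 < T → ∀ μ : MeasureTheory.Measure Literature.MathematicalPhysics.KineticTheory.HeatConduction.ChainConfig, (Literature.MathematicalPhysics.KineticTheory.HeatConduction.pinnedChain ω₂ lam β γ).IsChainGibbsMeasure T μ → Literature.MathematicalPhysics.KineticTheory.HeatConduction.IsShiftInvariant μ → μ.map (fun σ : Literature.MathematicalPhysics.KineticTheory.HeatConduction.ChainConfig => fun x : ℤ => ((σ x).1, -(σ x).2)) = μ → ∀ D : Literature.MathematicalPhysics.KineticTheory.HeatConduction.InfiniteChainDynamics (Literature.MathematicalPhysics.KineticTheory.HeatConduction.pinnedChain ω₂ lam β γ), D.PreservesMeasure μ → (∀ t : ℝ, ∀ᵐ σ ∂μ, D.flow t (Literature.MathematicalPhysics.KineticTheory.HeatConduction.shift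 σ) = Literature.MathematicalPhysics.KineticTheory.HeatConduction.shift (D.flow t σ)) → ∀ M : ℝ, 0 < M → ∀ F : ℝ → ℝ, F = (fun u : ℝ => max (-M) (min M u)) → ∃ ε₀ : ℝ, 0 < ε₀ ∧ ∃ K : ℝ, ∀ ε : ℝ, 0 < ε → ε ≤ ε₀ → ∀ τ : ℝ, 1 ≤ τ → ∃ L₀ : ℕ, ∀ L : ℕ, L₀ ≤ L → ∀ G : Literature.MathematicalPhysics.KineticTheory.HeatConduction.ChainConfig → ℝ, G = (fun σ : Literature.MathematicalPhysics.KineticTheory.HeatConduction.ChainConfig => ∑ x ∈ Finset.Icc (-(L : ℤ)) (L : ℤ), F ((Literature.MathematicalPhysics.KineticTheory.HeatConduction.pinnedChain ω₂ lam β γ).bondCurrentZ σ x)) → |(τ⁻¹ * ∫ t in (0:ℝ)..τ, ((∫ σ, F ((Literature.MathematicalPhysics.KineticTheory.HeatConduction.pinnedChain ω₂ lam β γ).bondCurrentZ (D.flow t σ) 0) * Real.exp (ε * G σ) ∂μ) / (∫ σ, Real.exp (ε * G σ) ∂μ) - ∫ σ, F ((Literature.MathematicalPhysics.KineticTheory.HeatConduction.pinnedChain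 ω₂ lam β γ).bondCurrentZ (D.flow t σ) 0) ∂μ)) - ε * (τ⁻¹ * ∫ t in (0:ℝ)..τ, ((∫ σ, F ((Literature.MathematicalPhysics.KineticTheory.HeatConduction.pinnedChain ω₂ lam β γ).bondCurrentZ (D.flow t σ) 0) * G σ ∂μ) - (∫ σ, F ((Literature.MathematicalPhysics.KineticTheory.HeatConduction.pinnedChain ω₂ lam β γ).bondCurrentZ (D.flow t σ) 0) ∂μ) * (∫ σ, G σ ∂μ)))| ≤ K * ε ^ 2

-- earlier BoundedOddRigidity (stmt-AtomisticToContinuum-9186, replaced 2026-08-15T16:37:43Z -> stmt-AtomisticToContinuum-11027): retired by None — ∀ ω₂ lam β γ : ℝ, 0 < ω₂ → 0 < lam → 0 < β → ∀ ν : MeasureTheory.Measure Literature.MathematicalPhysics.KineticTheory.HeatConduction.ChainConfig, MeasureTheory.IsProbabilityMeasure ν → Literature.Barriers.AtomisticToContinuum.HeatConduction.IsShiftInvaria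
/-- item stmt-AtomisticToContinuum-11027 · crux · rank 3 · open · by planner
why it might fail: Open for every deterministic anharmonic chain: KAM tori may carry locally a.c. stationary states, harmonic chains have regular current-carrying ones (FFL1994 p.215); a hidden quasi-local odd charge Q gives a regular invariant counterexample e^(λQ)μ_T (Mazur1969); generator ⊋ flow invariance.
sources: FritzFunakiLebowitz1994, Bernardin2014, SpohnLebowitz1977, Mazur1969, GurevichSuhov1976, decl Literature.Barriers.AtomisticToContinuum.MacroErgodicityHypothesis
[crux] (the card's named hypothesis OddMacroErgodicity, typed for bounded observables) for ω₂, lam,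
β > 0: every probability measure on (ℝ×ℝ)^ℤ that is shift-invariant, time-invariant for the infinite
deterministic pinned chain in the generator sense (∫𝒜f dν = 0, f ∈ C₀¹) and regular (decls
IsShiftInvariant / IsTimeInvariant / IsRegular of
Literature.MathematicalPhysics.KineticTheory.InfiniteChainInvariantStates — the fact-free home of
the infinite-chain vocabulary; route-repair 2026-08-15 re-homed the route there from the aliases of
the barrier file MacroErgodicityHypothesis.lean, definitionally equal) gives zero mean to every
clipped bond current, ∫ max(−M, min(M, j_0)) dν = 0 (M > 0). Implied by MacroErgodicityHypothesis +
reversal symmetry of the Gibbs states (support OddRigidityOfMacroErgodicity); implies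
ZeroCurrentRigidity = stmt-AtomisticToContinuum-2739 by dominated convergence (support
OddRigidityTransfer, PROVED in the sketch); false at lam = β = 0 (current-carrying Gaussian
stationary states, SpohnLebowitz1977). Needed only at ONE large M per temperature. [difficulty:
open-problem] -/
@[route_item "route-AtomisticToContinuum-CurrentTiltQuench", crux]
def BoundedOddRigidity : Prop :=
  ∀ ω₂ lam β γ : ℝ, 0 < ω₂ → 0 < lam → 0 < β → ∀ ν : MeasureTheory.Measure Literature.MathematicalPhysics.KineticTheory.HeatConduction.ChainConfig, MeasureTheory.IsProbabilityMeasure ν → Literature.MathematicalPhysics.KineticTheory.HeatConduction.IsShiftInvariant ν → Literature.MathematicalPhysics.KineticTheory.HeatConduction.IsTimeInvariant (Literature.MathematicalPhysics.KineticTheory.HeatConduction.pinnedChain ω₂ lam β γ) ν → Literature.MathematicalPhysics.KineticTheory.HeatConduction.IsRegular (Literature.MathematicalPhysics.KineticTheory.HeatConduction.pinnedChain ω₂ lam β γ) ν → ∀ M : ℝ, 0 < M → ∫ σ, max (-M) (min M ((Literature.MathematicalPhysics.KineticTheory.HeatConduction.pinnedChain ω₂ lam β γ).bondCurrentZ σ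 0)) ∂ν = 0

-- earlier QuenchCurrentDies (stmt-AtomisticToContinuum-9187, replaced 2026-08-15T16:37:43Z -> stmt-AtomisticToContinuum-11028): retired by None — ∀ ω₂ lam β γ : ℝ, 0 < ω₂ → 0 < lam → 0 < β → ∀ T : ℝ, 0 < T → ∀ μ : MeasureTheory.Measure Literature.MathematicalPhysics.KineticTheory.HeatConduction.ChainConfig, (Literature.MathematicalPhysics.KineticTheory.HeatConduction.pinnedChain ω₂ lam β γ).IsChainG
/-- item stmt-AtomisticToContinuum-11028 · crux · rank 4 · open · by planner
why it might fail: Needs light-cone quasi-locality of the infinite quartic-V flow twice (L→∞ at fixed τ on the non-local F(j_0)∘φ_t; entropy non-increase ⇒ regular Cesàro limits), printed only for deg V ≤ ½deg U (ButtaEtAl2007 Thm 2.2; LLL1977 A4 fails for β>0), plus generator invariance of limits via UI of q³ terms.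
sources: ButtaEtAl2007, LanfordLebowitzLieb1977, Bernardin2014, FritzFunakiLebowitz1994, Georgii2011, KipnisLandim1999
[crux] (card item TiltedStateLimit, repaired order of limits) for the symmetric set-up, M, ε > 0: IF
every shift-invariant, time-invariant, regular probability ν has ∫F_M(j_0)dν = 0, THEN ∀δ>0 ∃τ₀
∀τ≥τ₀ ∃L₀ ∀L≥L₀: |τ⁻¹∫₀^τ[⟨F_M(j_0)∘φ_t⟩_{ν_{ε,L}} − ⟨F_M(j_0)⟩_{μ_T}]dt| ≤ δ. Proof plan
(compactness): the Cesàro-averaged quench states ν̄_{τ,L} = τ⁻¹∫₀^τ(φ_t)_*ν_{ε,L}dt are tight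
(superstability); L → ∞ limit points are shift-invariant (shift-covariance + quasi-locality of φ_t +
Gibbs mixing) with box entropies ≤ CεM(|Λ| + vτ); τ → ∞ limit points have specific entropy ≤ CεM,
hence (shift-invariance, Markov reference) are regular; they are time-invariant because ∫𝒜f dν̄_τ =
τ⁻¹⟨f∘φ_τ − f⟩ = O(‖f‖_∞/τ) with 𝒜f uniformly integrable (|𝒜f| ≲ Σ|p| + |q|³ against quartic
pinning), and carry the limiting clipped current (bounded continuous); rigidity forces 0, while
⟨F_M(j_0)⟩_{μ_T} = 0 by reversal symmetry. [difficulty: L] -/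
@[route_item "route-AtomisticToContinuum-CurrentTiltQuench", crux]
def QuenchCurrentDies : Prop :=
  ∀ ω₂ lam β γ : ℝ, 0 < ω₂ → 0 < lam → 0 < β → ∀ T : ℝ, 0 < T → ∀ μ : MeasureTheory.Measure Literature.MathematicalPhysics.KineticTheory.HeatConduction.ChainConfig, (Literature.MathematicalPhysics.KineticTheory.HeatConduction.pinnedChain ω₂ lam β γ).IsChainGibbsMeasure T μ → Literature.MathematicalPhysics.KineticTheory.HeatConduction.IsShiftInvariant μ → μ.map (fun σ : Literature.MathematicalPhysics.KineticTheory.HeatConduction.ChainConfig => fun x : ℤ => ((σ x).1, -(σ x).2)) = μ → ∀ D : Literature.MathematicalPhysics.KineticTheory.HeatConduction.InfiniteChainDynamics (Literature.MathematicalPhysics.KineticTheory.HeatConduction.pinnedChain ω₂ lam β γ), D.PreservesMeasure μ → (∀ t : ℝ, ∀ᵐ σ ∂μ, D.flow t (Literature.MathematicalPhysics.KineticTheory.HeatConduction.shift σ) = Literature.MathematicalPhysics.KineticTheory.HeatConduction.shift (D.flow t σ)) → ∀ M : ℝ, 0 < M → ∀ F : ℝ → ℝ, F = (fun u : ℝ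 => max (-M) (min M u)) → (∀ ν : MeasureTheory.Measure Literature.MathematicalPhysics.KineticTheory.HeatConduction.ChainConfig, MeasureTheory.IsProbabilityMeasure ν → Literature.MathematicalPhysics.KineticTheory.HeatConduction.IsShiftInvariant ν → Literature.MathematicalPhysics.KineticTheory.HeatConduction.IsTimeInvariant (Literature.MathematicalPhysics.KineticTheory.HeatConduction.pinnedChain ω₂ lam β γ) ν → Literature.MathematicalPhysics.KineticTheory.HeatConduction.IsRegular (Literature.MathematicalPhysics.KineticTheory.HeatConduction.pinnedChain ω₂ lam β γ) ν → ∫ σ, F ((Literature.MathematicalPhysics.KineticTheory.HeatConduction.pinnedChain ω₂ lam β γ).bondCurrentZ σ 0) ∂ν = 0) → ∀ ε : ℝ, 0 < ε → ∀ δ : ℝ, 0 < δ → ∃ τ₀ : ℝ, ∀ τ : ℝ, τ₀ ≤ τ → ∃ L₀ : ℕ, ∀ L : ℕ, L₀ ≤ L → ∀ G : Literature.MathematicalPhysics.KineticTheory.HeatConduction.ChainConfig → ℝ, G = (fun σ : Literature.MathematicalPhysics.KineticTheory.HeatConduction.ChainConfig => ∑ x ∈ Finset.Icc (-(L : ℤ))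 (L : ℤ), F ((Literature.MathematicalPhysics.KineticTheory.HeatConduction.pinnedChain ω₂ lam β γ).bondCurrentZ σ x)) → |(τ⁻¹ * ∫ t in (0:ℝ)..τ, ((∫ σ, F ((Literature.MathematicalPhysics.KineticTheory.HeatConduction.pinnedChain ω₂ lam β γ).bondCurrentZ (D.flow t σ) 0) * Real.exp (ε * G σ) ∂μ) / (∫ σ, Real.exp (ε * G σ) ∂μ) - ∫ σ, F ((Literature.MathematicalPhysics.KineticTheory.HeatConduction.pinnedChain ω₂ lam β γ).bondCurrentZ (D.flow t σ) 0) ∂μ))| ≤ δ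

-- earlier GreenKuboOfNoDrude (stmt-AtomisticToContinuum-9188, replaced 2026-08-15T16:37:43Z -> stmt-AtomisticToContinuum-11029): retired by None — ∀ ω₂ lam β γ : ℝ, 0 < ω₂ → 0 < lam → 0 < β → 0 < γ → ∀ T : ℝ, 0 < T → (∀ μ : MeasureTheory.Measure Literature.MathematicalPhysics.KineticTheory.HeatConduction.ChainConfig, (Literature.MathematicalPhysics.KineticTheory.HeatConduction.pinnedChain ω₂ lam β γ
/-- item stmt-AtomisticToContinuum-11029 · crux · rank 5 · open · by planner
why it might fail: = stmt-0703 minus the atom at 0: zero Cesàro mean gives neither C_T ∈ L¹ (kinetic FPU-β tail t^(-3/5), LukkarinenSpohn2008; breather tails at low T; pinned κ<∞ only numerical, AokiLukkarinenSpohn2006) nor κ_GK>0; summable C_T needs unprinted quartic-V propagation bounds; vacuous w/o SymmetricSetup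
sources: BonettoLebowitzReyBellet2000, Bernardin2014, LukkarinenSpohn2008, AokiLukkarinenSpohn2006, Spohn2014, Mazur1969
[crux] IMPORT SLOT ('Green–Kubo minus the ballistic atom'): for all parameters > 0 and T > 0, IF for
every symmetric set-up (μ_T, φ) and every M the truncated Drude weight vanishes in the
NoTruncatedDrude form (∀η ∃τ₀ ∀τ≥τ₀ ∃L₀ ∀L≥L₀ |A_M(L,τ)| ≤ η), THEN there are a Gibbs state and a
μ_T-preserving dynamics with HasGreenKubo (C_T absolutely convergent, in L¹(0,∞), κ_GK > 0) —
literally the body of crux FourierGreenKubo (stmt-AtomisticToContinuum-0703) at T. NOT this route's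
mechanism: the residual is the REGULAR part of the current spectral measure σ_T near 0 (integrable
Fourier transform, positive density), the object of cards herglotz-current-spectral-measure /
embedded-drude-eigenvalue-mourre-fgr and of route FourierGreenKubo; any decay proof of 0703 closes
it a fortiori. [deps: NoTruncatedDrude, SymmetricSetup] [difficulty: open-problem] -/
@[route_item "route-AtomisticToContinuum-CurrentTiltQuench", crux]
def GreenKuboOfNoDrude : Prop :=
  ∀ ω₂ lam β γ : ℝ, 0 < ω₂ → 0 < lam → 0 < β → 0 < γ → ∀ T : ℝ, 0 < T → (∀ μ : MeasureTheory.Measure Literature.MathematicalPhysics.KineticTheory.HeatConduction.ChainConfig, (Literature.MathematicalPhysics.KineticTheory.HeatConduction.pinnedChain ω₂ lam β γ).IsChainGibbsMeasure T μ → Literature.MathematicalPhysics.KineticTheory.HeatConduction.IsShiftInvariant μ → μ.map (fun σ : Literature.MathematicalPhysics.KineticTheory.HeatConduction.ChainConfig => fun x : ℤ => ((σ x).1, -(σ x).2)) = μ → ∀ D : Literature.MathematicalPhysics.KineticTheory.HeatConduction.InfiniteChainDynamics (Literature.MathematicalPhysics.KineticTheory.HeatConduction.pinnedChain ω₂ lam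 β γ), D.PreservesMeasure μ → (∀ t : ℝ, ∀ᵐ σ ∂μ, D.flow t (Literature.MathematicalPhysics.KineticTheory.HeatConduction.shift σ) = Literature.MathematicalPhysics.KineticTheory.HeatConduction.shift (D.flow t σ)) → ∀ M : ℝ, 0 < M → ∀ F : ℝ → ℝ, F = (fun u : ℝ => max (-M) (min M u)) → ∀ η : ℝ, 0 < η → ∃ τ₀ : ℝ, ∀ τ : ℝ, τ₀ ≤ τ → ∃ L₀ : ℕ, ∀ L : ℕ, L₀ ≤ L → ∀ G : Literature.MathematicalPhysics.KineticTheory.HeatConduction.ChainConfig → ℝ, G = (fun σ : Literature.MathematicalPhysics.KineticTheory.HeatConduction.ChainConfig => ∑ x ∈ Finset.Icc (-(L : ℤ)) (L : ℤ), F ((Literature.MathematicalPhysics.KineticTheory.HeatConduction.pinnedChain ω₂ lam β γ).bondCurrentZ σ x)) → |(τ⁻¹ * ∫ t in (0:ℝ)..τ, ((∫ σ, F ((Literature.MathematicalPhysics.KineticTheory.HeatConduction.pinnedChain ω₂ lam β γ).bondCurrentZ (D.flow t σ) 0) * G σ ∂μ) - (∫ σ, F ((Literature.MathematicalPhysics.KineticTheory.HeatConduction.pinnedChain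 ω₂ lam β γ).bondCurrentZ (D.flow t σ) 0) ∂μ) * (∫ σ, G σ ∂μ)))| ≤ η) → ∃ μ : MeasureTheory.Measure Literature.MathematicalPhysics.KineticTheory.HeatConduction.ChainConfig, (Literature.MathematicalPhysics.KineticTheory.HeatConduction.pinnedChain ω₂ lam β γ).IsChainGibbsMeasure T μ ∧ ∃ D : Literature.MathematicalPhysics.KineticTheory.HeatConduction.InfiniteChainDynamics (Literature.MathematicalPhysics.KineticTheory.HeatConduction.pinnedChain ω₂ lam β γ), D.PreservesMeasure μ ∧ D.HasGreenKubo μ T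

/-- item stmt-AtomisticToContinuum-0717 · support · rank 9 · closed · proved by Summit.AtomisticToContinuum.FouriersLaw.Theorems.FourierGreenKubo.finiteResponseOfUnique_holds (prover) · by planner
sources: HairerMajda2009, ReyBellet2003
CONDITIONAL FORM OF 0705 (supersedes it as the prover target; refuters pool-5/g3-0: 0705 stand-alone
quantifies over EVERY steady-state family and is false-prone if weak steady states were non-unique):
assuming UNIQUENESS of weak steady states (IsSteadyState class) for pinnedChain at all N, T_L, T_R >
0, the finite-N linear-response limit D_N(T) = lim_{δ→0, δ≠0} totalCurrent(μ_{N,T+δ/2,T−δ/2})/δ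
exists for every T > 0 and N. Content: differentiability at equilibrium of NESS expectations of the
polynomial currents in the bath temperatures (ReyBellet2003 arXiv:math-ph/0303021 Rem 4.4 (51)–(56)
finite-volume Green–Kubo; HairerMajda2009 arXiv:0909.4313 Thm 2.3 framework — their SDE Thm 4.4
Assumption 5 fails here, so verify Assumptions 1–3 via CEHR2018 (2.5)/Carmona2007 Thm 1.1(iv)
weighted spectral gap). N = 0, 1: totalCurrent ≡ 0, D = 0. Together with 0706 gives 0705. -/
@[route_item "route-AtomisticToContinuum-CurrentTiltQuench", crux]
def FiniteResponseOfUnique : Prop :=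
  ∀ ω₂ lam β γ : ℝ, 0 < ω₂ → 0 < lam → 0 < β → 0 < γ → (∀ (N : ℕ) (T_L T_R : ℝ), 0 < T_L → 0 < T_R → ∀ μ ν : MeasureTheory.Measure (Literature.MathematicalPhysics.KineticTheory.HeatConduction.PhaseSpace N), (Literature.MathematicalPhysics.KineticTheory.HeatConduction.pinnedChain ω₂ lam β γ).IsSteadyState N T_L T_R μ → (Literature.MathematicalPhysics.KineticTheory.HeatConduction.pinnedChain ω₂ lam β γ).IsSteadyState N T_L T_R ν → μ = ν) → ∀ μ : (N : ℕ) → ℝ → ℝ → MeasureTheory.Measure (Literature.MathematicalPhysics.KineticTheory.HeatConduction.PhaseSpace N), (∀ (N : ℕ) (T_L T_R : ℝ), 0 < T_L → 0 < T_R → (Literature.MathematicalPhysics.KineticTheory.HeatConduction.pinnedChain ω₂ lam β γ).IsSteadyState N T_L T_R (μ N T_L T_R)) → ∀ T : ℝ, 0 < T → ∀ N : ℕ, ∃ D : ℝ, Filter.Tendsto (fun δ : ℝ => (Literature.MathematicalPhysics.KineticTheory.HeatConduction.pinnedChain ω₂ lam β γ).totalCurrent (μ N (T + δ / 2) (T -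 δ / 2)) / δ) (nhdsWithin 0 {(0 : ℝ)}ᶜ) (nhds D)

/-- `FiniteResponseOfUnique` holds: proved by `Summit.AtomisticToContinuum.FouriersLaw.Theorems.FourierGreenKubo.finiteResponseOfUnique_holds`. -/
theorem FiniteResponseOfUnique_holds : FiniteResponseOfUnique := _root_.Summit.AtomisticToContinuum.FouriersLaw.Theorems.FourierGreenKubo.finiteResponseOfUnique_holds

/-- item stmt-AtomisticToContinuum-0741 · support · rank 9 · closed · proved by Summit.AtomisticToContinuum.FouriersLaw.Theorems.nessUnique_proof (prover) · by planner
sources: CuneoEckmannHairerReyBellet2018, Carmona2007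
[crux] UNIQUENESS OF THE WEAK STEADY STATE (the half of stmt-0706 not covered by the landed fact
Literature.MathematicalPhysics.KineticTheory.HeatConduction.CuneoEckmannHairerReyBellet2018_pinnedChain,
p3544): for pinnedChain ω₂ lam β γ (all > 0), every N and T_L, T_R > 0, any two measures in the weak
Fokker–Planck class IsSteadyState (probability, ∫ L f dμ = 0 for f ∈ C_c^∞, bond currents
integrable) coincide. Print: uniqueness of the INVARIANT MEASURE of the Langevin semigroup
(CuneoEckmannHairerReyBellet2018 Thm 2.13(1): C1, C2, CA; Carmona2007 Thm 1.1(iii)); the item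
additionally needs 'weak stationary probability solution of L*μ = 0 ⇒ P_t-invariant' for this
hypoelliptic L with cubic drift (Echeverría 1982 well-posed martingale problem on C_c^∞ +
non-explosion via e^{θH}; Bogachev–Krylov–Röckner–Shaposhnikov 2015 Ch. 5 is non-degenerate only) —
the FP-identification lemma is the formal crux. N = 0: PhaseSpace 0 is a point (unique probability
measure); N = 1: both baths on site 0, OU at temperature (T_L+T_R)/2. This is exactly the hypothesis
of FiniteResponse and ThermodynamicLimit and, with the fact, gives clause (i) of FouriersLawFor. -/
@[route_item "route-AtomisticToContinuum-CurrentTiltQuench", crux]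
def NessUnique : Prop :=
  ∀ ω₂ lam β γ : ℝ, 0 < ω₂ → 0 < lam → 0 < β → 0 < γ → ∀ (N : ℕ) (T_L T_R : ℝ), 0 < T_L → 0 < T_R → ∀ μ ν : MeasureTheory.Measure (Literature.MathematicalPhysics.KineticTheory.HeatConduction.PhaseSpace N), (Literature.MathematicalPhysics.KineticTheory.HeatConduction.pinnedChain ω₂ lam β γ).IsSteadyState N T_L T_R μ → (Literature.MathematicalPhysics.KineticTheory.HeatConduction.pinnedChain ω₂ lam β γ).IsSteadyState N T_L T_R ν → μ = ν

/-- `NessUnique` holds: proved by `Summit.AtomisticToContinuum.FouriersLaw.Theorems.nessUnique_proof`. -/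
theorem NessUnique_holds : NessUnique := _root_.Summit.AtomisticToContinuum.FouriersLaw.Theorems.nessUnique_proof

/-- item stmt-AtomisticToContinuum-0742 · support · rank 9 · open · by planner
sources: BonettoLebowitzReyBellet2000, ReyBellet2003, KunduDharNarayan2009
[crux] THERMODYNAMIC LIMIT OF THE RESPONSE COEFFICIENT, WITNESS FORM (supersedes
stmt-AtomisticToContinuum-0704; refuters g12-0/1/2/3/5: the ∀(μ_T,D) form hid the claim that κ_GK is
the same for every DLR state and every dynamics). Under weak-NESS uniqueness and T > 0, IF some
Gibbs state with a μ_T-preserving Green–Kubo dynamics exists (hypothesis = GreenKubo at T), THEN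
there is such a pair (μ_T, D), fixed before the steady-state family is chosen, such that for every
steady-state family μ and every sequence Dn of finite-volume response coefficients (Dn N =
lim_{δ→0,δ≠0} totalCurrent(μ N (T+δ/2) (T−δ/2))/δ, existence = FiniteResponse, uniqueness of limits
makes Dn canonical) one has Dn → greenKuboConductivity D μ_T T. Content: finite-volume Kubo formula
(ReyBellet2003 Rem 4.4 (56)) + N-uniform decay of equilibrium current correlations of the Langevin
chain + o(1) boundary layers at the baths; open (BonettoLebowitzReyBellet2000 §7 after (37)). N = 0,
1: Dn = 0, irrelevant to atTop. -/
@[route_item "route-AtomisticToContinuum-CurrentTiltQuench", crux]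
def ThermodynamicLimit : Prop :=
  ∀ ω₂ lam β γ : ℝ, 0 < ω₂ → 0 < lam → 0 < β → 0 < γ → (∀ (N : ℕ) (T_L T_R : ℝ), 0 < T_L → 0 < T_R → ∀ μ ν : MeasureTheory.Measure (Literature.MathematicalPhysics.KineticTheory.HeatConduction.PhaseSpace N), (Literature.MathematicalPhysics.KineticTheory.HeatConduction.pinnedChain ω₂ lam β γ).IsSteadyState N T_L T_R μ → (Literature.MathematicalPhysics.KineticTheory.HeatConduction.pinnedChain ω₂ lam β γ).IsSteadyState N T_L T_R ν → μ = ν) → ∀ T : ℝ, 0 < T → (∃ μT : MeasureTheory.Measure Literature.MathematicalPhysics.KineticTheory.HeatConduction.ChainConfig, (Literature.MathematicalPhysics.KineticTheory.HeatConduction.pinnedChain ω₂ lam β γ).IsChainGibbsMeasure T μT ∧ ∃ D : Literature.MathematicalPhysics.KineticTheory.HeatConduction.InfiniteChainDynamics (Literature.MathematicalPhysics.KineticTheory.HeatConduction.pinnedChain ω₂ lam β γ), D.PreservesMeasure μT ∧ D.HasGreenKubo μT T) → ∃ (μT : MeasureTheory.Measure Literature.MathematicalPhysics.KineticTheory.HeatConduction.ChainConfig)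 (D : Literature.MathematicalPhysics.KineticTheory.HeatConduction.InfiniteChainDynamics (Literature.MathematicalPhysics.KineticTheory.HeatConduction.pinnedChain ω₂ lam β γ)), (Literature.MathematicalPhysics.KineticTheory.HeatConduction.pinnedChain ω₂ lam β γ).IsChainGibbsMeasure T μT ∧ D.PreservesMeasure μT ∧ D.HasGreenKubo μT T ∧ ∀ μ : (N : ℕ) → ℝ → ℝ → MeasureTheory.Measure (Literature.MathematicalPhysics.KineticTheory.HeatConduction.PhaseSpace N), (∀ (N : ℕ) (T_L T_R : ℝ), 0 < T_L → 0 < T_R → (Literature.MathematicalPhysics.KineticTheory.HeatConduction.pinnedChain ω₂ lam β γ).IsSteadyState N T_L T_R (μ N T_L T_R)) → ∀ Dn : ℕ → ℝ, (∀ N : ℕ, Filter.Tendsto (fun δ : ℝ => (Literature.MathematicalPhysics.KineticTheory.HeatConduction.pinnedChain ω₂ lam β γ).totalCurrent (μ N (T + δ / 2) (T - δ / 2)) / δ) (nhdsWithin 0 {(0 : ℝ)}ᶜ) (nhds (Dn N))) → Filter.Tendsto Dn Filter.atTop (nhds (D.greenKuboConductivity μT T))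

-- earlier NoTruncatedDrude (stmt-AtomisticToContinuum-9189, replaced 2026-08-15T16:37:43Z -> stmt-AtomisticToContinuum-11030): retired by None — ∀ ω₂ lam β γ : ℝ, 0 < ω₂ → 0 < lam → 0 < β → ∀ T : ℝ, 0 < T → ∀ μ : MeasureTheory.Measure Literature.MathematicalPhysics.KineticTheory.HeatConduction.ChainConfig, (Literature.MathematicalPhysics.KineticTheory.HeatConduction.pinnedChain ω₂ lam β γ).IsChainGi
/-- item stmt-AtomisticToContinuum-11030 · support · rank 9 · open · by planner
sources: Mazur1969, Suzuki1971, Doyon2022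
[support] THE DELIVERABLE (no ballistic channel, truncated form): for every symmetric set-up (μ_T,
φ) of pinnedChain (ω₂, lam, β > 0), T > 0, every M, η > 0: ∃τ₀ ∀τ≥τ₀ ∃L₀ ∀L≥L₀ |τ⁻¹∫₀^τ
Cov_{μ_T}(G_L, F_M(j_0)∘φ_t)dt| ≤ η. Closed by BridgeGlue from ranks 2–4; stated alone so that
FourierGreenKubo (Cesàro half of stmt-0703), the Herglotz card and the junction/Fekete lines can
want it. [difficulty: L] -/
@[route_item "route-AtomisticToContinuum-CurrentTiltQuench", crux]
def NoTruncatedDrude : Prop :=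
  ∀ ω₂ lam β γ : ℝ, 0 < ω₂ → 0 < lam → 0 < β → ∀ T : ℝ, 0 < T → ∀ μ : MeasureTheory.Measure Literature.MathematicalPhysics.KineticTheory.HeatConduction.ChainConfig, (Literature.MathematicalPhysics.KineticTheory.HeatConduction.pinnedChain ω₂ lam β γ).IsChainGibbsMeasure T μ → Literature.MathematicalPhysics.KineticTheory.HeatConduction.IsShiftInvariant μ → μ.map (fun σ : Literature.MathematicalPhysics.KineticTheory.HeatConduction.ChainConfig => fun x : ℤ => ((σ x).1, -(σ x).2)) = μ → ∀ D : Literature.MathematicalPhysics.KineticTheory.HeatConduction.InfiniteChainDynamics (Literature.MathematicalPhysics.KineticTheory.HeatConduction.pinnedChain ω₂ lam β γ), D.PreservesMeasure μ → (∀ t : ℝ, ∀ᵐ σ ∂μ, D.flow t (Literature.MathematicalPhysics.KineticTheory.HeatConduction.shift σ) = Literature.MathematicalPhysics.KineticTheory.HeatConduction.shift (D.flow t σ)) → ∀ M : ℝ, 0 < M → ∀ F : ℝ → ℝ, F = (fun u : ℝ => max (-M) (min M u)) → ∀ η : ℝ, 0 < η → ∃ τ₀ : ℝ, ∀ τ :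 ℝ, τ₀ ≤ τ → ∃ L₀ : ℕ, ∀ L : ℕ, L₀ ≤ L → ∀ G : Literature.MathematicalPhysics.KineticTheory.HeatConduction.ChainConfig → ℝ, G = (fun σ : Literature.MathematicalPhysics.KineticTheory.HeatConduction.ChainConfig => ∑ x ∈ Finset.Icc (-(L : ℤ)) (L : ℤ), F ((Literature.MathematicalPhysics.KineticTheory.HeatConduction.pinnedChain ω₂ lam β γ).bondCurrentZ σ x)) → |(τ⁻¹ * ∫ t in (0:ℝ)..τ, ((∫ σ, F ((Literature.MathematicalPhysics.KineticTheory.HeatConduction.pinnedChain ω₂ lam β γ).bondCurrentZ (D.flow t σ) 0) * G σ ∂μ) - (∫ σ, F ((Literature.MathematicalPhysics.KineticTheory.HeatConduction.pinnedChain ω₂ lam β γ).bondCurrentZ (D.flow t σ) 0) ∂μ) * (∫ σ, G σ ∂μ)))| ≤ η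

-- earlier FluctuationStateDichotomy (stmt-AtomisticToContinuum-9191, replaced 2026-08-15T16:37:43Z -> stmt-AtomisticToContinuum-11031): retired by None — UniformQuadraticResponse → QuenchCurrentDies → ∀ ω₂ lam β γ : ℝ, 0 < ω₂ → 0 < lam → 0 < β → ∀ T : ℝ, 0 < T → ∀ μ : MeasureTheory.Measure Literature.MathematicalPhysics.KineticTheory.HeatConduction.ChainConfig, (Literature.MathematicalPhysics.Kineti
/-- item stmt-AtomisticToContinuum-11031 · support · rank 9 · closed · proved by Summit.AtomisticToContinuum.FouriersLaw.Theorems.CurrentTiltQuench.fluctuationStateDichotomy_proof @ 895fdc92d54b (prover) · by planner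
sources: SpohnLebowitz1977, doi:10.1007/bf01010871, FritzFunakiLebowitz1994
[support] THE CARD'S BY-PRODUCT THEOREM as a provable-now schema (refuter g40-52's advice on the
retired twin: typed WITH its two antecedents): UniformQuadraticResponse → QuenchCurrentDies → for a
symmetric set-up and M > 0, if the truncated Drude weight does NOT vanish (∃η>0 such that for
unboundedly many τ and, given τ, unboundedly many L, |A_M(L,τ)| > η), then there is a
shift-invariant, time-invariant, REGULAR probability measure of the infinite pinned chain with
non-zero mean clipped current — a non-Gibbsian space-time-invariant state manufactured from
equilibrium current fluctuations (harmonic picture: the current-carrying Gaussian states of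
SpohnLebowitz1977). Pure logic (PROVED in the sketch, theorem dichotomy, rc 0). [difficulty:
provable-now] -/
@[route_item "route-AtomisticToContinuum-CurrentTiltQuench"]
def FluctuationStateDichotomy : Prop :=
  UniformQuadraticResponse → QuenchCurrentDies → ∀ ω₂ lam β γ : ℝ, 0 < ω₂ → 0 < lam → 0 < β → ∀ T : ℝ, 0 < T → ∀ μ : MeasureTheory.Measure Literature.MathematicalPhysics.KineticTheory.HeatConduction.ChainConfig, (Literature.MathematicalPhysics.KineticTheory.HeatConduction.pinnedChain ω₂ lam β γ).IsChainGibbsMeasure T μ → Literature.MathematicalPhysics.KineticTheory.HeatConduction.IsShiftInvariant μ → μ.map (fun σ : Literature.MathematicalPhysics.KineticTheory.HeatConduction.ChainConfig => fun x : ℤ => ((σ x).1, -(σ x).2)) = μ → ∀ D : Literature.MathematicalPhysics.KineticTheory.HeatConduction.InfiniteChainDynamics (Literature.MathematicalPhysics.KineticTheory.HeatConduction.pinnedChain ω₂ lam β γ), D.PreservesMeasure μ → (∀ t : ℝ, ∀ᵐ σ ∂μ, D.flow t (Literature.MathematicalPhysics.KineticTheory.HeatConduction.shift σ) = Literature.MathematicalPhysics.KineticTheory.HeatConduction.shift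 (D.flow t σ)) → ∀ M : ℝ, 0 < M → ∀ F : ℝ → ℝ, F = (fun u : ℝ => max (-M) (min M u)) → (∃ η : ℝ, 0 < η ∧ ∀ τ₀ : ℝ, ∃ τ : ℝ, τ₀ ≤ τ ∧ ∀ L₀ : ℕ, ∃ L : ℕ, L₀ ≤ L ∧ ∀ G : Literature.MathematicalPhysics.KineticTheory.HeatConduction.ChainConfig → ℝ, G = (fun σ : Literature.MathematicalPhysics.KineticTheory.HeatConduction.ChainConfig => ∑ x ∈ Finset.Icc (-(L : ℤ)) (L : ℤ), F ((Literature.MathematicalPhysics.KineticTheory.HeatConduction.pinnedChain ω₂ lam β γ).bondCurrentZ σ x)) → η < |(τ⁻¹ * ∫ t in (0:ℝ)..τ, ((∫ σ, F ((Literature.MathematicalPhysics.KineticTheory.HeatConduction.pinnedChain ω₂ lam β γ).bondCurrentZ (D.flow t σ) 0) * G σ ∂μ) - (∫ σ, F ((Literature.MathematicalPhysics.KineticTheory.HeatConduction.pinnedChain ω₂ lam β γ).bondCurrentZ (D.flow t σ) 0) ∂μ) * (∫ σ, G σ ∂μ)))|) → ∃ ν : MeasureTheory.Measure Literature.MathematicalPhysics.KineticTheory.HeatConduction.ChainConfig,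 MeasureTheory.IsProbabilityMeasure ν ∧ Literature.MathematicalPhysics.KineticTheory.HeatConduction.IsShiftInvariant ν ∧ Literature.MathematicalPhysics.KineticTheory.HeatConduction.IsTimeInvariant (Literature.MathematicalPhysics.KineticTheory.HeatConduction.pinnedChain ω₂ lam β γ) ν ∧ Literature.MathematicalPhysics.KineticTheory.HeatConduction.IsRegular (Literature.MathematicalPhysics.KineticTheory.HeatConduction.pinnedChain ω₂ lam β γ) ν ∧ ∫ σ, F ((Literature.MathematicalPhysics.KineticTheory.HeatConduction.pinnedChain ω₂ lam β γ).bondCurrentZ σ 0) ∂ν ≠ 0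

-- earlier DrudeFromTruncation (stmt-AtomisticToContinuum-9192, replaced 2026-08-15T16:37:43Z -> stmt-AtomisticToContinuum-11032): retired by None — ∀ ω₂ lam β γ : ℝ, 0 < ω₂ → 0 < lam → 0 < β → ∀ T : ℝ, 0 < T → ∀ μ : MeasureTheory.Measure Literature.MathematicalPhysics.KineticTheory.HeatConduction.ChainConfig, (Literature.MathematicalPhysics.KineticTheory.HeatConduction.pinnedChain ω₂ lam β γ).IsChai
/-- item stmt-AtomisticToContinuum-11032 · support · rank 9 · open · by planner
sources: Mazur1969, Suzuki1971, Doyon2022, decl Literature.Barriers.AtomisticToContinuum.Mazur.tendsto_inv_mul_integral_inner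
[support] TRANSLATION TO THE CLASSICAL DRUDE WEIGHT: for a symmetric set-up whose current
correlations converge absolutely at all times (HasAbsConvergentCorrelation, as inside HasGreenKubo),
NoTruncatedDrude at (μ_T, φ) for all M implies τ⁻¹∫₀^τ currentCorrelation dt → 0 (σ_T({0}) = 0).
Content: von Neumann in ℋ₀ (PROVED abstractly in tree: Mazur.tendsto_inv_mul_integral_inner) —
Cesàro limits exist and equal ‖P₀·‖²; P₀ is a contraction and ‖j_0 − F_M(j_0)‖_ℋ₀ → 0 is a STATIC
Gibbs estimate (summable covariances of local functions), so √D ≤ √D_M + o_M(1); plus the L → ∞ swap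
at fixed τ (dominated convergence from quasi-locality). [difficulty: M] -/
@[route_item "route-AtomisticToContinuum-CurrentTiltQuench", crux]
def DrudeFromTruncation : Prop :=
  ∀ ω₂ lam β γ : ℝ, 0 < ω₂ → 0 < lam → 0 < β → ∀ T : ℝ, 0 < T → ∀ μ : MeasureTheory.Measure Literature.MathematicalPhysics.KineticTheory.HeatConduction.ChainConfig, (Literature.MathematicalPhysics.KineticTheory.HeatConduction.pinnedChain ω₂ lam β γ).IsChainGibbsMeasure T μ → Literature.MathematicalPhysics.KineticTheory.HeatConduction.IsShiftInvariant μ → μ.map (fun σ : Literature.MathematicalPhysics.KineticTheory.HeatConduction.ChainConfig => fun x : ℤ => ((σ x).1, -(σ x).2)) = μ → ∀ D : Literature.MathematicalPhysics.KineticTheory.HeatConduction.InfiniteChainDynamics (Literature.MathematicalPhysics.KineticTheory.HeatConduction.pinnedChain ω₂ lam β γ), D.PreservesMeasure μ → (∀ t : ℝ, ∀ᵐ σ ∂μ, D.flow t (Literature.MathematicalPhysics.KineticTheory.HeatConduction.shift σ) = Literature.MathematicalPhysics.KineticTheory.HeatConduction.shift (D.flow t σ)) → (∀ t : ℝ, D.HasAbsConvergentCorrelation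 μ t) → (∀ M : ℝ, 0 < M → ∀ F : ℝ → ℝ, F = (fun u : ℝ => max (-M) (min M u)) → ∀ η : ℝ, 0 < η → ∃ τ₀ : ℝ, ∀ τ : ℝ, τ₀ ≤ τ → ∃ L₀ : ℕ, ∀ L : ℕ, L₀ ≤ L → ∀ G : Literature.MathematicalPhysics.KineticTheory.HeatConduction.ChainConfig → ℝ, G = (fun σ : Literature.MathematicalPhysics.KineticTheory.HeatConduction.ChainConfig => ∑ x ∈ Finset.Icc (-(L : ℤ)) (L : ℤ), F ((Literature.MathematicalPhysics.KineticTheory.HeatConduction.pinnedChain ω₂ lam β γ).bondCurrentZ σ x)) → |(τ⁻¹ * ∫ t in (0:ℝ)..τ, ((∫ σ, F ((Literature.MathematicalPhysics.KineticTheory.HeatConduction.pinnedChain ω₂ lam β γ).bondCurrentZ (D.flow t σ) 0) * G σ ∂μ) - (∫ σ, F ((Literature.MathematicalPhysics.KineticTheory.HeatConduction.pinnedChain ω₂ lam β γ).bondCurrentZ (D.flow t σ) 0) ∂μ) * (∫ σ, G σ ∂μ)))| ≤ η) → Filter.Tendsto (fun τ : ℝ => τ⁻¹ * ∫ t in (0:ℝ)..τ,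 D.currentCorrelation μ t) Filter.atTop (nhds 0)

-- earlier OddRigidityOfMacroErgodicity (stmt-AtomisticToContinuum-9193, replaced 2026-08-15T16:37:43Z -> stmt-AtomisticToContinuum-11034): retired by None — Literature.Barriers.AtomisticToContinuum.MacroErgodicityHypothesis → (∀ ω₂ lam β γ : ℝ, 0 < ω₂ → 0 < lam → 0 < β → ∀ T : ℝ, 0 < T → ∀ μ : MeasureTheory.Measure Literature.MathematicalPhysics.KineticTheory.HeatConduction.ChainConfig, (Literature.
/-- item stmt-AtomisticToContinuum-11034 · support · rank 9 · closed · proved by Summit.AtomisticToContinuum.FouriersLaw.Theorems.CurrentTiltQuench.oddRigidityOfMacroErgodicity_proof @ 9599ae64dcc5 (prover) · by planner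
sources: Bernardin2014, FritzFunakiLebowitz1994, Georgii2011
[support] the catalogue hypothesis implies the crux: MacroErgodicityHypothesis (=
Literature.Barriers.AtomisticToContinuum.MacroErgodicityHypothesis, written out VERBATIM as its body
∀ ω₂ lam β γ > 0, IsMacroErgodic (pinnedChain ω₂ lam β γ) over
Literature.MathematicalPhysics.KineticTheory.InfiniteChainInvariantStates, so that the open XL fact
is a HYPOTHESIS of this support item and not a constant in the route cone — route-repair 2026-08-15;
`Iff.rfl` with the old form) → (every DLR Gibbs state of pinnedChain at every T' > 0 is
momentum-reversal invariant — the 1-D uniqueness/symmetry input made an explicit hypothesis) →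
BoundedOddRigidity (ν = ∫μ_T' π(dT'); F_M(j_0) is bounded and odd under p ↦ −p; Measure.bind
integral). [difficulty: provable-now] -/
@[route_item "route-AtomisticToContinuum-CurrentTiltQuench"]
def OddRigidityOfMacroErgodicity : Prop :=
  (∀ ω₂ lam β γ : ℝ, 0 < ω₂ → 0 < lam → 0 < β → Literature.MathematicalPhysics.KineticTheory.HeatConduction.IsMacroErgodic (Literature.MathematicalPhysics.KineticTheory.HeatConduction.pinnedChain ω₂ lam β γ)) → (∀ ω₂ lam β γ : ℝ, 0 < ω₂ → 0 < lam → 0 < β → ∀ T : ℝ, 0 < T → ∀ μ : MeasureTheory.Measure Literature.MathematicalPhysics.KineticTheory.HeatConduction.ChainConfig, (Literature.MathematicalPhysics.KineticTheory.HeatConduction.pinnedChain ω₂ lam β γ).IsChainGibbsMeasure T μ → μ.map (fun σ : Literature.MathematicalPhysics.KineticTheory.HeatConduction.ChainConfig => fun x : ℤ => ((σ x).1, -(σ x).2)) = μ) → BoundedOddRigidity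

-- earlier OddRigidityTransfer (stmt-AtomisticToContinuum-9194, replaced 2026-08-15T16:37:43Z -> stmt-AtomisticToContinuum-11035): retired by None — BoundedOddRigidity → ∀ ω₂ lam β γ : ℝ, 0 < ω₂ → 0 < lam → 0 < β → ∀ ν : MeasureTheory.Measure Literature.MathematicalPhysics.KineticTheory.HeatConduction.ChainConfig, MeasureTheory.IsProbabilityMeasure ν → Literature.Barriers.AtomisticToContinuum.HeatCon
/-- item stmt-AtomisticToContinuum-11035 · support · rank 9 · closed · proved by Summit.AtomisticToContinuum.FouriersLaw.Theorems.CurrentTiltQuench.oddRigidityTransfer_proof @ 45ecc971dae9 (prover) · by planner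
sources: FritzFunakiLebowitz1994, folklore (planner Sketch.lean theorem oddRigidityTransfer)
[support] BoundedOddRigidity → ZeroCurrentRigidity of route LocalOhmRigidity (consequent =
stmt-AtomisticToContinuum-2739 of the retired route LocalOhmRigidity up to the alias→original
renames of route-repair 2026-08-15, definitionally equal): clip at level n+1 and let n → ∞ by
dominated convergence (|F_(n+1)(j_0)| ≤ |j_0| ∈ L¹(ν)). PROVED in the planner's Sketch.lean (theorem
oddRigidityTransfer, rc 0): provers of rank 3 close stmt-2739 as well. [difficulty: provable-now] -/
@[route_item "route-AtomisticToContinuum-CurrentTiltQuench"]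
def OddRigidityTransfer : Prop :=
  BoundedOddRigidity → ∀ ω₂ lam β γ : ℝ, 0 < ω₂ → 0 < lam → 0 < β → ∀ ν : MeasureTheory.Measure Literature.MathematicalPhysics.KineticTheory.HeatConduction.ChainConfig, MeasureTheory.IsProbabilityMeasure ν → Literature.MathematicalPhysics.KineticTheory.HeatConduction.IsShiftInvariant ν → Literature.MathematicalPhysics.KineticTheory.HeatConduction.IsTimeInvariant (Literature.MathematicalPhysics.KineticTheory.HeatConduction.pinnedChain ω₂ lam β γ) ν → Literature.MathematicalPhysics.KineticTheory.HeatConduction.IsRegular (Literature.MathematicalPhysics.KineticTheory.HeatConduction.pinnedChain ω₂ lam β γ) ν → MeasureTheory.Integrable (fun σ => (Literature.MathematicalPhysics.KineticTheory.HeatConduction.pinnedChain ω₂ lam β γ).bondCurrentZ σ 0) ν → ∫ σ, (Literature.MathematicalPhysics.KineticTheory.HeatConduction.pinnedChain ω₂ lam β γ).bondCurrentZ σ 0 ∂ν = 0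

-- earlier SymmetricSetup (stmt-AtomisticToContinuum-9195, replaced 2026-08-15T16:37:43Z -> stmt-AtomisticToContinuum-11036): retired by None — ∀ ω₂ lam β γ : ℝ, 0 < ω₂ → 0 < lam → 0 < β → ∀ T : ℝ, 0 < T → ∃ μ : MeasureTheory.Measure Literature.MathematicalPhysics.KineticTheory.HeatConduction.ChainConfig, (Literature.MathematicalPhysics.KineticTheory.HeatConduction.pinnedChain ω₂ lam β γ).IsChainGibb
/-- item stmt-AtomisticToContinuum-11036 · support · rank 9 · closed · proved by Summit.AtomisticToContinuum.FouriersLaw.Theorems.CurrentTiltQuench.hoelderEscapeProfile_symmetricSetup_proof @ 7ae88a1c43c2 (prover) · by planner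
sources: LanfordLebowitzLieb1977, ButtaEtAl2007, Georgii2011
[support] DE-VACUIFIER / infrastructure (InfiniteVolumeSetup = stmt-0743 of FourierGreenKubo
strengthened by the symmetries this line uses): for ω₂, lam, β > 0 (any γ) and T > 0 there are a DLR
Gibbs state μ_T that is shift-invariant and momentum-reversal invariant (1-D transfer operator
e^(−U/2T)e^(−V(q′−q)/T)e^(−U/2T), Hilbert–Schmidt since U ≥ ω₂q²/2: unique, hence symmetric) and an
InfiniteChainDynamics preserving μ_T whose flow commutes with the shift μ_T-a.e. (LLL1977 Thm 3 a.e.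
existence on a shift-invariant tempered carrier + a uniqueness class; ButtaEtAl2007 for quartic
forces). [difficulty: L] -/
@[route_item "route-AtomisticToContinuum-CurrentTiltQuench"]
def SymmetricSetup : Prop :=
  ∀ ω₂ lam β γ : ℝ, 0 < ω₂ → 0 < lam → 0 < β → ∀ T : ℝ, 0 < T → ∃ μ : MeasureTheory.Measure Literature.MathematicalPhysics.KineticTheory.HeatConduction.ChainConfig, (Literature.MathematicalPhysics.KineticTheory.HeatConduction.pinnedChain ω₂ lam β γ).IsChainGibbsMeasure T μ ∧ Literature.MathematicalPhysics.KineticTheory.HeatConduction.IsShiftInvariant μ ∧ μ.map (fun σ : Literature.MathematicalPhysics.KineticTheory.HeatConduction.ChainConfig => fun x : ℤ => ((σ x).1, -(σ x).2)) = μ ∧ ∃ D : Literature.MathematicalPhysics.KineticTheory.HeatConduction.InfiniteChainDynamics (Literature.MathematicalPhysics.KineticTheory.HeatConduction.pinnedChain ω₂ lam β γ), D.PreservesMeasure μ ∧ ∀ t : ℝ, ∀ᵐ σ ∂μ, D.flow t (Literature.MathematicalPhysics.KineticTheory.HeatConduction.shift σ) = Literature.MathematicalPhysics.KineticTheory.HeatConduction.shift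 (D.flow t σ)

/-- item stmt-AtomisticToContinuum-9190 · support · rank 9 · closed · proved by Summit.AtomisticToContinuum.FouriersLaw.Theorems.CurrentTiltQuench.bridgeGlue_proof @ af828c340efd (prover) · by planner
sources: Mazur1969, folklore (planner Sketch.lean theorem bridgeGlue)
[support] UniformQuadraticResponse → QuenchCurrentDies → BoundedOddRigidity → NoTruncatedDrude: pure
logic plus |εX| ≤ |Y − εX| + |Y| with ε = min(ε₀, η/(2(|K|+1))), δ = εη/2 (PROVED in the planner's
Sketch.lean, theorem bridgeGlue, rc 0 — a prover may copy it). [difficulty: provable-now] -/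
@[route_item "route-AtomisticToContinuum-CurrentTiltQuench"]
def BridgeGlue : Prop :=
  UniformQuadraticResponse → QuenchCurrentDies → BoundedOddRigidity → NoTruncatedDrude

/-- item stmt-AtomisticToContinuum-9196 · assembly · rank 1 · open · by planner
sources: BonettoLebowitzReyBellet2000, decl Literature.HeatConduction.fouriersLaw_of_ness_greenKubo_thermodynamicLimit
[assembly] UniformQuadraticResponse → QuenchCurrentDies → BoundedOddRigidity → GreenKuboOfNoDrude →
NessUnique → FiniteResponseOfUnique → ThermodynamicLimit → FouriersLaw (the type of `closes`,
curried). -/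
@[route_item "route-AtomisticToContinuum-CurrentTiltQuench"]
def Assembly : Prop :=
  UniformQuadraticResponse → QuenchCurrentDies → BoundedOddRigidity → GreenKuboOfNoDrude → NessUnique → FiniteResponseOfUnique → ThermodynamicLimit → _root_.FouriersLaw

/-! D-0027 §2.1 — DECIDING THEOREM (planner-authored via `route open/edit --closes-file`; by planner-rrepair-AtomisticToContinuum-CurrentTi-4831b40c-g2-0 2026-08-15T16:37:43Z):
its hypotheses are this route's items and its conclusion the sub-problem Statement (glue_lint), and it elaborates with this file. -/

@[closes "route-AtomisticToContinuum-CurrentTiltQuench"] theorem closes (hU : UniformQuadraticResponse) (hQ : QuenchCurrentDies) (hB : BoundedOddRigidity)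
    (hGK : GreenKuboOfNoDrude) (hNU : NessUnique) (hFR : FiniteResponseOfUnique) (hTL : ThermodynamicLimit) :
    _root_.FouriersLaw := by
  -- (1) the bridge: UniformQuadraticResponse + QuenchCurrentDies + BoundedOddRigidity ⇒ NoTruncatedDrude (pure logic + |εX| ≤ |Y−εX| + |Y|)
  have hbridge : NoTruncatedDrude := by
    intro ω₂ lam β γ hω hl hβ T hT μ hGibbs hS hR D hPres hCov M hM F hF η hη
    obtain ⟨ε₀, hε₀, K, hK⟩ := hU ω₂ lam β γ hω hl hβ T hT μ hGibbs hS hR D hPres hCov M hM F hF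
    have hrig : ∀ ν : MeasureTheory.Measure Literature.MathematicalPhysics.KineticTheory.HeatConduction.ChainConfig,
        MeasureTheory.IsProbabilityMeasure ν → Literature.MathematicalPhysics.KineticTheory.HeatConduction.IsShiftInvariant ν →
        Literature.MathematicalPhysics.KineticTheory.HeatConduction.IsTimeInvariant (Literature.MathematicalPhysics.KineticTheory.HeatConduction.pinnedChain ω₂ lam β γ) ν →
        Literature.MathematicalPhysics.KineticTheory.HeatConduction.IsRegular (Literature.MathematicalPhysics.KineticTheory.HeatConduction.pinnedChain ω₂ lam β γ) ν →
        ∫ σ, F ((Literature.MathematicalPhysics.KineticTheory.HeatConduction.pinnedChain ω₂ lam β γ).bondCurrentZ σ 0) ∂ν = 0 := by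
      intro ν h1 h2 h3 h4
      subst hF
      exact hB ω₂ lam β γ hω hl hβ ν h1 h2 h3 h4 M hM
    set ε : ℝ := min ε₀ (η / (2 * (|K| + 1))) with hεdef
    have hKpos : 0 < |K| + 1 := by positivity
    have hεpos : 0 < ε := lt_min hε₀ (by positivity)
    have hεle : ε ≤ ε₀ := min_le_left _ _
    have hεle' : ε ≤ η / (2 * (|K| + 1)) := min_le_right _ _
    obtain ⟨τ₀, hτ₀⟩ := hQ ω₂ lam β γ hω hl hβ T hT μ hGibbs hS hR D hPres hCov M hM F hF hrig ε hεpos (ε * η / 2)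
      (by positivity)
    refine ⟨max τ₀ 1, fun τ hτ => ?_⟩
    obtain ⟨L₁, hL₁⟩ := hτ₀ τ (le_of_max_le_left hτ)
    obtain ⟨L₂, hL₂⟩ := hK ε hεpos hεle τ (le_of_max_le_right hτ)
    refine ⟨max L₁ L₂, fun L hL G hG => ?_⟩
    have h1 := hL₁ L (le_of_max_le_left hL) G hG
    have h2 := hL₂ L (le_of_max_le_right hL) G hG
    generalize hX : (τ⁻¹ * ∫ t in (0:ℝ)..τ, ((∫ σ, F ((Literature.MathematicalPhysics.KineticTheory.HeatConduction.pinnedChain ω₂ lam β γ).bondCurrentZ (D.flow t σ) 0) * G σ ∂μ) - (∫ σ, F ((Literature.MathematicalPhysics.KineticTheory.HeatConduction.pinnedChain ω₂ lam β γ).bondCurrentZ (D.flow t σ) 0) ∂μ) * (∫ σ, G σ ∂μ))) = X at h2 ⊢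
    generalize hYY : (τ⁻¹ * ∫ t in (0:ℝ)..τ, ((∫ σ, F ((Literature.MathematicalPhysics.KineticTheory.HeatConduction.pinnedChain ω₂ lam β γ).bondCurrentZ (D.flow t σ) 0) * Real.exp (ε * G σ) ∂μ) / (∫ σ, Real.exp (ε * G σ) ∂μ) - ∫ σ, F ((Literature.MathematicalPhysics.KineticTheory.HeatConduction.pinnedChain ω₂ lam β γ).bondCurrentZ (D.flow t σ) 0) ∂μ)) = Y at h1 h2
    have h3 : ε * |X| ≤ K * ε ^ 2 + ε * η / 2 := by
      have : |ε * X| ≤ |Y - ε * X| + |Y| := by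
        calc |ε * X| = |Y - (Y - ε * X)| := by ring_nf
          _ ≤ |Y| + |Y - ε * X| := abs_sub _ _
          _ = |Y - ε * X| + |Y| := by ring
      rw [abs_mul, abs_of_pos hεpos] at this
      linarith
    have h4 : |X| ≤ K * ε + η / 2 := by
      have h3' : ε * |X| ≤ ε * (K * ε + η / 2) := by
        calc ε * |X| ≤ K * ε ^ 2 + ε * η / 2 := h3
          _ = ε * (K * ε + η / 2) := by ring
      exact le_of_mul_le_mul_left h3' hεpos
    have h5 : K * ε ≤ η / 2 := by
      have hK1 : K * ε ≤ |K| * (η / (2 * (|K| + 1))) :=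
        (mul_le_mul_of_nonneg_right (le_abs_self K) hεpos.le).trans (mul_le_mul_of_nonneg_left hεle' (abs_nonneg K))
      have hK2 : |K| * (η / (2 * (|K| + 1))) ≤ η / 2 := by
        rw [← mul_div_assoc, div_le_iff₀ (by positivity : (0:ℝ) < 2 * (|K| + 1))]
        have : η / 2 * (2 * (|K| + 1)) = |K| * η + η := by ring
        rw [this]
        linarith
      linarith
    linarith
  -- (2) FouriersLaw = ∀ parameters, FouriersLawFor: clause (i) from the landed existence fact + NessUnique; clause (ii) with
  --     κ(T) read off the ThermodynamicLimit witnesses for the Green–Kubo pair supplied by GreenKuboOfNoDrude ∘ bridge.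
  intro ω₂ lam β γ hω hl hβ hγ
  have huniq := hNU ω₂ lam β γ hω hl hβ hγ
  refine ⟨?_, ?_⟩
  · intro N T_L T_R hL hR
    obtain ⟨μ, hμ⟩ :=
      Literature.MathematicalPhysics.KineticTheory.HeatConduction.pinnedChain_exists_isSteadyState hω hl hβ hγ N hL hR
    exact ⟨μ, hμ, fun ν hν => huniq N T_L T_R hL hR ν μ hν hμ⟩
  · have hGKT : ∀ T : ℝ, 0 < T →
        ∃ μ : MeasureTheory.Measure Literature.MathematicalPhysics.KineticTheory.HeatConduction.ChainConfig,
          (Literature.MathematicalPhysics.KineticTheory.HeatConduction.pinnedChain ω₂ lam β γ).IsChainGibbsMeasure T μ ∧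
          ∃ D : Literature.MathematicalPhysics.KineticTheory.HeatConduction.InfiniteChainDynamics
              (Literature.MathematicalPhysics.KineticTheory.HeatConduction.pinnedChain ω₂ lam β γ),
            D.PreservesMeasure μ ∧ D.HasGreenKubo μ T := fun T hT =>
      hGK ω₂ lam β γ hω hl hβ hγ T hT (hbridge ω₂ lam β γ hω hl hβ T hT)
    classical
    have hW := fun T (hT : 0 < T) => hTL ω₂ lam β γ hω hl hβ hγ huniq T hT (hGKT T hT)
    let μT := fun T (hT : 0 < T) => Classical.choose (hW T hT)
    have hμT := fun T (hT : 0 < T) => Classical.choose_spec (hW T hT)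
    let DT := fun T (hT : 0 < T) => Classical.choose (hμT T hT)
    have hDT := fun T (hT : 0 < T) => Classical.choose_spec (hμT T hT)
    refine ⟨fun T => if hT : 0 < T then (DT T hT).greenKuboConductivity (μT T hT) T else 1, ?_, ?_⟩
    · intro T hT
      simp only [dif_pos hT]
      exact (hDT T hT).2.2.1.pos
    · intro μ hμ T hT
      have hD := hFR ω₂ lam β γ hω hl hβ hγ huniq μ hμ T hT
      refine ⟨fun N => Classical.choose (hD N), fun N => Classical.choose_spec (hD N), ?_⟩
      simp only [dif_pos hT]
      exact (hDT T hT).2.2.2 μ hμ (fun N => Classical.choose (hD N)) (fun N => Classical.choose_spec (hD N))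

end Summit.AtomisticToContinuum.FouriersLaw.Theses.CurrentTiltQuench
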